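import Mathlib
import Summits.Ventures.HodgeRepro.Tier4.Common.AdelicDefs
import Summits.Ventures.HodgeRepro.Tier4.Line1.RationalPoints
import Summits.Ventures.HodgeRepro.Tier4.Line1.PrincipalDiscrete
import Summits.Ventures.HodgeRepro.Tier4.Line1.LocallyCompactGA
import Summits.Ventures.HodgeRepro.Tier4.Line1.SecondCountableGA
import Summits.Ventures.HodgeRepro.Tier4.Line1.AdelicBlichfeldt
import Summits.Ventures.HodgeRepro.Tier4.Line1.PlaneDefs

/-!
# Tier4/Line1/CocompactAssembly — rung C8 of the R-c cut: the Mostow–Tamagawa assembly, modulo C3, C5, C6, C7, hstab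

Blind re-derivation cell `pub-hodge-repro`, Tier 4 (README §9–§10), seat t4-L1-p5 (prover, LINE L1, gen 0).
The cut of the cocompactness wall (S12723 / S12785): from (C3) «`𝔸_k/k` compact» (hence the adelic Blichfeldt C4,
`Tier4/Line1/AdelicBlichfeldt.lean`), (C5) the modulus `μ(S g) = μ(S)` for `g ∈ U(W)(𝔸_k)`, (C6) Witt for the hermitian
plane, (C7) the fibration over a stabiliser, and `hstab` (cocompactness of `Stab(v)(k)` in `Stab(v)(𝔸_k)` for every
non-zero rational `v` — the torus theorem in stabiliser form), R-c follows: for `g ∈ U(W)(𝔸_k)` Blichfeldt gives a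
non-zero rational `x` with `x g` in a fixed compact `C₀`; the two rational invariants `h(x,x)` take finitely many values
there (M2, `finite_principal_inter_of_isCompact`); Witt moves `x` to one of finitely many representatives `v`, the
fibration writes `γ g = s κ` with `s` in the stabiliser of `v` and `κ` in a compact, and `hstab` writes `s = γ' κ′`.
Every hypothesis is DISPLAYED; nothing is claimed about C5/C7 (the walls-in-the-wall).

Nothing here says anything about the status of the Hodge conjecture for CM abelian varieties, which is NOT proved
(HC_CM is NOT proved by anyone in this repository).
-/

set_option autoImplicit false

noncomputable section

namespace Summit.Ventures.HodgeRepro.Tier4.Line1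

open NumberField MeasureTheory Topology Set Common Matrix
open scoped ENNReal Pointwise

section Assembly

variable {k : Type} [Field k] [NumberField k] (W : PlaneData k)

omit [NumberField k] in
/-- The completion of `k` at an infinite place is not compact: the naturals are unbounded in norm. -/
theorem noncompactSpace_infinitePlaceCompletion (w : InfinitePlace k) : NoncompactSpace w.Completion := by
  refine ⟨fun hc => ?_⟩
  obtain ⟨R, hR⟩ := Bornology.IsBounded.exists_norm_le hc.isBounded
  obtain ⟨n, hn⟩ := exists_nat_gt R
  have h1 : ‖((n : k) : w.Completion)‖ = n := by
    rw [InfinitePlace.Completion.norm_coe]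
    show w (n : k) = n
    rw [← InfinitePlace.mk_embedding w, InfinitePlace.apply, map_natCast, Complex.norm_natCast]
  have h2 := hR ((n : k) : w.Completion) (Set.mem_univ _)
  rw [h1] at h2
  exact absurd (lt_of_lt_of_le hn h2) (lt_irrefl _)

/-- `𝔸_k⁴` is not compact (an infinite place is a non-compact completion). -/
theorem noncompactSpace_adelePow : NoncompactSpace (Fin 4 → Ad k) := by
  classical
  obtain ⟨w⟩ := (inferInstance : Nonempty (InfinitePlace k))
  haveI := noncompactSpace_infinitePlaceCompletion (k := k) w
  refine ⟨fun hc => ?_⟩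
  have hf : Continuous fun x : Fin 4 → Ad k => (x 0).1 w :=
    ((continuous_apply w).comp (continuous_fst.comp (continuous_apply 0)))
  have hsurj : Function.Surjective fun x : Fin 4 → Ad k => (x 0).1 w := by
    intro y
    refine ⟨fun _ => ((Function.update (0 : (v : InfinitePlace k) → v.Completion) w y : InfiniteAdeleRing k), 0), ?_⟩
    show Function.update (0 : (v : InfinitePlace k) → v.Completion) w y w = y
    exact Function.update_self w y 0
  have h1 : IsCompact (Set.univ : Set w.Completion) := by
    rw [← Set.image_univ_of_surjective hsurj]
    exact hc.image hf
  exact noncompact_univ w.Completion h1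

/-- **Minkowski for the group (C4 + C5)**: there is a compact `C₀ ⊆ 𝔸_k⁴` such that every `g ∈ U(W)(𝔸_k)` moves some
non-zero rational vector into `C₀`. -/
theorem exists_compact_forall_exists_rational_vecMul_mem
    (h3 : ∃ C : Set (AdeleRing (𝓞 k) k), IsCompact C ∧
      ∀ x : AdeleRing (𝓞 k) k, ∃ a : k, x - algebraMap k (AdeleRing (𝓞 k) k) a ∈ C)
    (h5 : ∀ [MeasurableSpace (Fin 4 → Ad k)] [BorelSpace (Fin 4 → Ad k)]
      (μ : Measure (Fin 4 → Ad k)) [μ.IsAddHaarMeasure] (g : GA W) (S : Set (Fin 4 → Ad k)),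
      μ ((fun x => x ᵥ* GA.mat W g) '' S) = μ S) :
    ∃ C₀ : Set (Fin 4 → Ad k), IsCompact C₀ ∧ ∀ g : GA W, ∃ x : Fin 4 → k, x ≠ 0 ∧
      (fun i => algebraMap k (Ad k) (x i)) ᵥ* GA.mat W g ∈ C₀ := by
  classical
  haveI := t2Space_adeleRing k
  haveI := locallyCompactSpace_adeleRing k
  haveI := secondCountable_adeleRing k
  haveI : LocallyCompactSpace (Fin 4 → Ad k) := Pi.locallyCompactSpace_of_finite
  haveI : SecondCountableTopology (Fin 4 → Ad k) := inferInstance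
  haveI : NoncompactSpace (Fin 4 → Ad k) := noncompactSpace_adelePow
  letI : MeasurableSpace (Fin 4 → Ad k) := borel _
  haveI : BorelSpace (Fin 4 → Ad k) := ⟨rfl⟩
  let μ : Measure (Fin 4 → Ad k) := Measure.addHaar
  obtain ⟨c₀, hc₀, hB⟩ := exists_ne_zero_rational_mem_sub_of k h3 μ
  -- a compact set of measure `> c₀`
  have huniv : μ Set.univ = ∞ := measure_univ_of_isAddLeftInvariant μ
  have hcov : (Set.univ : Set (Fin 4 → Ad k)) = ⋃ n, compactCovering (Fin 4 → Ad k) n :=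
    (iUnion_compactCovering _).symm
  have hsup : μ Set.univ = ⨆ n, μ (compactCovering (Fin 4 → Ad k) n) := by
    rw [hcov]
    exact Monotone.measure_iUnion (s := compactCovering (Fin 4 → Ad k)) (compactCovering_subset _)
  obtain ⟨n, hn⟩ : ∃ n, c₀ < μ (compactCovering (Fin 4 → Ad k) n) := by
    rw [← lt_iSup_iff, ← hsup, huniv]
    exact hc₀
  set S₀ := compactCovering (Fin 4 → Ad k) n with hS₀def
  have hS₀ : IsCompact S₀ := isCompact_compactCovering _ n
  refine ⟨(fun p : (Fin 4 → Ad k) × (Fin 4 → Ad k) => p.1 - p.2) '' (S₀ ×ˢ S₀),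
    (hS₀.prod hS₀).image continuous_sub, ?_⟩
  intro g
  -- `S := S₀ g⁻¹` has measure `μ S₀ > c₀`
  let S : Set (Fin 4 → Ad k) := (fun x => x ᵥ* GA.mat W g) ⁻¹' S₀
  have hSeq : S = (fun x => x ᵥ* GA.mat W g⁻¹) '' S₀ := by
    ext x
    simp only [S, Set.mem_preimage, Set.mem_image]
    constructor
    · intro hx
      refine ⟨x ᵥ* GA.mat W g, hx, ?_⟩
      rw [vecMul_vecMul, GA.mat_mul_inv, vecMul_one]
    · rintro ⟨y, hy, rfl⟩
      rw [vecMul_vecMul, GA.mat_inv_mul, vecMul_one]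
      exact hy
  have hSmeas : MeasurableSet S :=
    (hS₀.isClosed.preimage (continuous_id.matrix_vecMul continuous_const)).measurableSet
  have hSμ : c₀ < μ S := by
    rw [hSeq, h5 μ g⁻¹ S₀]
    exact hn
  obtain ⟨x, hx0, s, hs, t, ht, hst⟩ := hB S hSmeas hSμ
  refine ⟨x, hx0, ⟨(s ᵥ* GA.mat W g, t ᵥ* GA.mat W g), ⟨hs, ht⟩, ?_⟩⟩
  simp only
  rw [← sub_vecMul, hst]


/-- the adelic bilinear form `u B vᵀ` of the plane -/
theorem bil_vecMul_invariant (g : GA W) (u v : Fin 4 → Ad k) :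
    (u ᵥ* GA.mat W g) ᵥ* adMat k W.B ⬝ᵥ (v ᵥ* GA.mat W g) = u ᵥ* adMat k W.B ⬝ᵥ v := by
  have hB : GA.mat W g * adMat k W.B * (GA.mat W g)ᵀ = adMat k W.B := g.2.2
  rw [vecMul_vecMul, ← mulVec_transpose (GA.mat W g) v, dotProduct_mulVec, vecMul_vecMul, hB]

/-- the rational invariant `x B xᵀ`, read adelically -/
theorem algebraMap_bil (x y : Fin 4 → k) :
    algebraMap k (Ad k) (x ᵥ* W.B ⬝ᵥ y) =
      (fun i => algebraMap k (Ad k) (x i)) ᵥ* adMat k W.B ⬝ᵥ (fun i => algebraMap k (Ad k) (y i)) := by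
  rw [RingHom.map_dotProduct]
  congr 1
  funext i
  exact RingHom.map_vecMul (algebraMap k (Ad k)) W.B x i

/-- `(x Ω)` read adelically -/
theorem algebraMap_vecMul_Ω (x : Fin 4 → k) :
    (fun i => algebraMap k (Ad k) ((x ᵥ* W.Ω) i)) =
      (fun i => algebraMap k (Ad k) (x i)) ᵥ* adMat k W.Ω := by
  funext i
  exact RingHom.map_vecMul (algebraMap k (Ad k)) W.Ω x i

/-- (C8) **THE MOSTOW–TAMAGAWA ASSEMBLY**: R-c from C3 (`𝔸_k/k` compact), C5 (the modulus), C6 (Witt), C7 (the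
fibration over a stabiliser) and `hstab` (cocompactness of the stabiliser of every non-zero rational vector — the
torus theorem in stabiliser form). -/
theorem cocompact_rationalPoints_of_rungs
    (h3 : ∃ C : Set (AdeleRing (𝓞 k) k), IsCompact C ∧
      ∀ x : AdeleRing (𝓞 k) k, ∃ a : k, x - algebraMap k (AdeleRing (𝓞 k) k) a ∈ C)
    (h5 : ∀ [MeasurableSpace (Fin 4 → Ad k)] [BorelSpace (Fin 4 → Ad k)]
      (μ : Measure (Fin 4 → Ad k)) [μ.IsAddHaarMeasure] (g : GA W) (S : Set (Fin 4 → Ad k)),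
      μ ((fun x => x ᵥ* GA.mat W g) '' S) = μ S)
    (h6 : ∀ x y : Fin 4 → k, x ≠ 0 → y ≠ 0 → x ᵥ* W.B ⬝ᵥ x = y ᵥ* W.B ⬝ᵥ y →
      (x ᵥ* W.Ω) ᵥ* W.B ⬝ᵥ x = (y ᵥ* W.Ω) ᵥ* W.B ⬝ᵥ y →
      ∃ γ : rationalPoints W, (fun i => algebraMap k (Ad k) (x i)) ᵥ* GA.mat W (γ : GA W) =
        fun i => algebraMap k (Ad k) (y i))
    (h7 : ∀ v₀ : Fin 4 → k, v₀ ≠ 0 → ∀ C₀ : Set (Fin 4 → Ad k), IsCompact C₀ →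
      ∃ K : Set (GA W), IsCompact K ∧ ∀ g : GA W,
        (fun i => algebraMap k (Ad k) (v₀ i)) ᵥ* GA.mat W g ∈ C₀ →
          ∃ s : GA W, (fun i => algebraMap k (Ad k) (v₀ i)) ᵥ* GA.mat W s =
            (fun i => algebraMap k (Ad k) (v₀ i)) ∧ ∃ κ ∈ K, g = s * κ)
    (hstab : ∀ v : Fin 4 → k, v ≠ 0 → ∃ K : Set (GA W), IsCompact K ∧ ∀ s : GA W,
      (fun i => algebraMap k (Ad k) (v i)) ᵥ* GA.mat W s = (fun i => algebraMap k (Ad k) (v i)) →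
        ∃ γ : rationalPoints W, (fun i => algebraMap k (Ad k) (v i)) ᵥ* GA.mat W (γ : GA W) =
          (fun i => algebraMap k (Ad k) (v i)) ∧ ∃ κ ∈ K, s = (γ : GA W) * κ) :
    ∃ C : Set (GA W), IsCompact C ∧ ∀ g : GA W, ∃ γ : rationalPoints W, ∃ c ∈ C, g = (γ : GA W) * c := by
  classical
  obtain ⟨C₀, hC₀, hmink⟩ := exists_compact_forall_exists_rational_vecMul_mem W h3 h5
  haveI := t2Space_adeleRing k
  -- the two invariants on `C₀` take finitely many rational values
  let q₁ : (Fin 4 → Ad k) → Ad k := fun y => y ᵥ* adMat k W.B ⬝ᵥ y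
  let q₂ : (Fin 4 → Ad k) → Ad k := fun y => (y ᵥ* adMat k W.Ω) ᵥ* adMat k W.B ⬝ᵥ y
  have hq₁ : Continuous q₁ := (continuous_id.matrix_vecMul continuous_const).dotProduct continuous_id
  have hq₂ : Continuous q₂ :=
    ((continuous_id.matrix_vecMul continuous_const).matrix_vecMul continuous_const).dotProduct
      continuous_id
  have hN₁ : {n : k | algebraMap k (Ad k) n ∈ q₁ '' C₀}.Finite :=
    finite_principal_inter_of_isCompact k (hC₀.image hq₁)
  have hN₂ : {n : k | algebraMap k (Ad k) n ∈ q₂ '' C₀}.Finite :=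
    finite_principal_inter_of_isCompact k (hC₀.image hq₂)
  -- the representatives
  let Rep : k × k → Set (Fin 4 → k) := fun p =>
    {x | x ≠ 0 ∧ x ᵥ* W.B ⬝ᵥ x = p.1 ∧ (x ᵥ* W.Ω) ᵥ* W.B ⬝ᵥ x = p.2}
  let Kfin : k × k → Set (GA W) := fun p =>
    if h : (Rep p).Nonempty then
      Classical.choose (hstab (Classical.choose h) (Classical.choose_spec h).1) *
        Classical.choose (h7 (Classical.choose h) (Classical.choose_spec h).1 C₀ hC₀)
    else ∅
  have hKfin : ∀ p, IsCompact (Kfin p) := by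
    intro p
    simp only [Kfin]
    split_ifs with h
    · exact (Classical.choose_spec (hstab (Classical.choose h) (Classical.choose_spec h).1)).1.mul
        (Classical.choose_spec (h7 (Classical.choose h) (Classical.choose_spec h).1 C₀ hC₀)).1
    · exact isCompact_empty
  refine ⟨⋃ p ∈ ({n : k | algebraMap k (Ad k) n ∈ q₁ '' C₀} ×ˢ
      {n : k | algebraMap k (Ad k) n ∈ q₂ '' C₀}), Kfin p,
    (hN₁.prod hN₂).isCompact_biUnion fun p _ => hKfin p, ?_⟩
  intro g
  obtain ⟨x, hx0, hxg⟩ := hmink g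
  -- the invariants of `x` are among the finitely many
  have hinv₁ : q₁ ((fun i => algebraMap k (Ad k) (x i)) ᵥ* GA.mat W g) =
      algebraMap k (Ad k) (x ᵥ* W.B ⬝ᵥ x) := by
    simp only [q₁]
    rw [bil_vecMul_invariant, algebraMap_bil]
  have hinv₂ : q₂ ((fun i => algebraMap k (Ad k) (x i)) ᵥ* GA.mat W g) =
      algebraMap k (Ad k) ((x ᵥ* W.Ω) ᵥ* W.B ⬝ᵥ x) := by
    have hΩ : GA.mat W g * adMat k W.Ω = adMat k W.Ω * GA.mat W g := g.2.1
    have e1 : ((fun i => algebraMap k (Ad k) (x i)) ᵥ* GA.mat W g) ᵥ* adMat k W.Ω =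
        ((fun i => algebraMap k (Ad k) (x i)) ᵥ* adMat k W.Ω) ᵥ* GA.mat W g := by
      rw [vecMul_vecMul, hΩ, vecMul_vecMul]
    show (((fun i => algebraMap k (Ad k) (x i)) ᵥ* GA.mat W g) ᵥ* adMat k W.Ω) ᵥ* adMat k W.B ⬝ᵥ
      ((fun i => algebraMap k (Ad k) (x i)) ᵥ* GA.mat W g) = _
    rw [e1, bil_vecMul_invariant, algebraMap_bil, algebraMap_vecMul_Ω]
  let p : k × k := (x ᵥ* W.B ⬝ᵥ x, (x ᵥ* W.Ω) ᵥ* W.B ⬝ᵥ x)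
  have hp : p ∈ {n : k | algebraMap k (Ad k) n ∈ q₁ '' C₀} ×ˢ
      {n : k | algebraMap k (Ad k) n ∈ q₂ '' C₀} :=
    ⟨⟨_, hxg, hinv₁⟩, ⟨_, hxg, hinv₂⟩⟩
  have hrep : (Rep p).Nonempty := ⟨x, hx0, rfl, rfl⟩
  -- the representative `v` of the type `p`, and Witt
  set v := Classical.choose hrep with hvdef
  have hv : v ∈ Rep p := Classical.choose_spec hrep
  obtain ⟨γ₁, hγ₁⟩ := h6 x v hx0 hv.1 hv.2.1.symm hv.2.2.symm
  -- `v (γ₁⁻¹ g) ∈ C₀`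
  have hvC₀ : (fun i => algebraMap k (Ad k) (v i)) ᵥ* GA.mat W ((γ₁ : GA W)⁻¹ * g) ∈ C₀ := by
    rw [← hγ₁, vecMul_vecMul, ← GA.mat_mul, ← mul_assoc, mul_inv_cancel, one_mul]
    exact hxg
  -- the fibration and the stabiliser
  obtain ⟨s, hs, κ, hκ, hgs⟩ :=
    (Classical.choose_spec (h7 v hv.1 C₀ hC₀)).2 _ hvC₀
  obtain ⟨γ₂, -, κ', hκ', hsκ'⟩ := (Classical.choose_spec (hstab v hv.1)).2 s hs
  refine ⟨γ₁ * γ₂, κ' * κ, ?_, ?_⟩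
  · refine Set.mem_biUnion hp ?_
    simp only [Kfin, dif_pos hrep]
    exact Set.mul_mem_mul hκ' hκ
  · rw [Subgroup.coe_mul]
    have : (γ₁ : GA W)⁻¹ * g = (γ₂ : GA W) * κ' * κ := by rw [hgs, hsκ']
    calc g = (γ₁ : GA W) * ((γ₁ : GA W)⁻¹ * g) := by rw [mul_inv_cancel_left]
      _ = (γ₁ : GA W) * ((γ₂ : GA W) * κ' * κ) := by rw [this]
      _ = (γ₁ : GA W) * (γ₂ : GA W) * (κ' * κ) := by simp only [mul_assoc]

end Assembly

end Summit.Ventures.HodgeRepro.Tier4.Line1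

end
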